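import Mathlib.Analysis.Asymptotics.SpecificAsymptotics
import Mathlib.Analysis.Real.Sqrt
import Mathlib.NumberTheory.LegendreSymbol.Basic
import Mathlib.NumberTheory.LegendreSymbol.JacobiSymbol
import Literature.NumberTheory.Sieve.BatemanHorn
import Literature.NumberTheory.Sieve.BatemanHornProofs
import Literature.NumberTheory.Sieve.ParityBatemanHorn
import Literature.NumberTheory.Sieve.ParityWave0
import Literature.NumberTheory.Sieve.AletheiaZomleferFukshanskyGarcia2020Applications
import HarnessLib

/-!
# Hardy–Littlewood's Conjecture E (primes `m² + 1`): the Euler product, the Bateman–Horn special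
# case, and the printed form

Topic `Literature/NumberTheory/Sieve` (family `parity`). Companion ("Proofs") file of
`Literature/NumberTheory/Sieve/ParityBatemanHorn.lean`, whose `Literature.NumberTheory.Sieve.HardyLittlewoodConjE`
(**parity.S37**) states Hardy–Littlewood's Conjecture E in the Bateman–Horn parametrisation
`#{m ≤ x : m² + 1 prime} ∼ (𝔖/2) · x / log x`, `𝔖 = lim_x ∏_{2 < p ≤ x} (1 - χ₋₄(p)/(p - 1))`.
`HardyLittlewoodConjE` itself is an OPEN conjecture — the source prints it as a conjecture
(Acta Math. 44 (1923), §5.42, p. 48), and it implies Landau's problem on primes `n² + 1`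
(`HardyLittlewoodConjE.landauConjecture` below) — so no `HardyLittlewoodConjE_holds` can exist.
This file proves everything around it that is provable:

* `Literature.NumberTheory.Sieve.polyRootCountMod_X_sq_add_one_holds` — DISCHARGE of the named fact
  `polyRootCountMod_X_sq_add_one` of `BatemanHorn.lean`: `ω_{X²+1}(p) = 1 + χ₋₄(p)` for odd primes
  `p` (square roots of `-1` mod `p`, first supplement to quadratic reciprocity);
* `Literature.NumberTheory.Sieve.batemanHornPartial_X_sq_add_one` — the termwise identity
  `∏_{p ≤ x} (1 - 1/p)⁻¹ (1 - ω_{X²+1}(p)/p) = ∏_{2 < p ≤ x} (1 - χ₋₄(p)/(p - 1))` (Bateman–Horn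
  1962, (1) with `f = n² + 1`, p. 365), whence `Literature.NumberTheory.Sieve.hasBatemanHornConst_X_sq_add_one_iff` and
  `Literature.batemanHornAsymptotic_X_sq_add_one_iff : BatemanHornAsymptotic ![X² + 1] ↔ HardyLittlewoodConjE`;
* `Literature.NumberTheory.Sieve.hardyLittlewoodConjE_of_batemanHorn_holds` — DISCHARGE of the named fact
  `hardyLittlewoodConjE_of_batemanHorn` (`BatemanHornConjecture → HardyLittlewoodConjE`);
* `Literature.NumberTheory.Sieve.tendsto_hardyLittlewoodE_partial_holds` — DISCHARGE of the named fact
  `tendsto_hardyLittlewoodE_partial` of `BatemanHorn.lean`: the ordered product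
  `∏_{2 < p ≤ x} (1 - χ₋₄(p)/(p - 1))` converges (to `hardyLittlewoodEConst > 0`,
  `Literature.NumberTheory.Sieve.hardyLittlewoodEConst_pos`), unconditionally, as the case `f = X² + 1` of the PROVED
  convergence theorem `IsBatemanHornSystem.hasBatemanHornConst_holds` (`BatemanHornProofs.lean`,
  Bateman–Horn 1962, pp. 364–365); consequently `Literature.NumberTheory.Sieve.hardyLittlewoodConjE_iff_isEquivalent`:
  Conjecture E is equivalent to the bare asymptotic
  `#{m ≤ x : m² + 1 prime} ∼ (hardyLittlewoodEConst/2) · x/log x`;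
* `Literature.NumberTheory.Sieve.HardyLittlewoodConjE.landauConjecture` — Conjecture E implies Landau's conjecture
  (the tree's `Parity.LandauConjecture`);
* the faithfulness theorem `Literature.NumberTheory.Sieve.hardyLittlewoodConjE_iff_printed`: `HardyLittlewoodConjE` is
  equivalent to Conjecture E **as printed** (infinitely many primes `m² + 1`, and
  `P(n) ∼ C √n / log n` for the number `P(n)` of such primes below `n`, with
  `C = ∏_{ϖ ≥ 3} (1 - (1/(ϖ − 1)) (−1/ϖ))`), the right-hand side spelled out inline; the proof is
  the reparametrisation `x = √n` (`P(n) = Q(⌊√(n - 2)⌋)`, `Q(x) = P(x² + 2)` with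
  `Q = nSqAddOnePrimeCount`).

## References

* G. H. Hardy, J. E. Littlewood, *Some problems of 'Partitio Numerorum'; III: On the expression of
  a number as a sum of primes*, Acta Math. 44 (1923), 1–70 (`HardyLittlewood1923`), §5.41
  (5.413) and §5.42, Conjecture E (p. 48).
* P. T. Bateman, R. A. Horn, *A heuristic asymptotic formula concerning the distribution of prime
  numbers*, Math. Comp. 16 (1962), 363–367 (`BatemanHornMathComp1962`), formula (1), pp. 364–365
  (convergence of the product) and p. 365 (the case `n² + 1`).
-/

noncomputable section

open Filter Finset Polynomial Asymptotics
open scoped Topology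

namespace Literature.NumberTheory.Sieve

/-! ### Local root counts of `X² + 1` -/

/-- **Discharge of `polyRootCountMod_X_sq_add_one`**: for an odd prime `p`,
`ω_{X²+1}(p) = 1 + χ₋₄(p)`. The residues `n < p` with `p ∣ n² + 1` are in bijection
(`n ↦ n mod p`, inverse `ZMod.val`) with the square roots of `-1` in `ZMod p`, whose number is
`(−1/p) + 1` (Mathlib's `legendreSym.card_sqrts`), and `(−1/p) = χ₋₄(p)` is the first supplement
to quadratic reciprocity (`legendreSym.at_neg_one`). Hardy–Littlewood 1923, §5.42 (the factor
`χ_ϖ = 1 − (−1/ϖ)/(ϖ − 1)`); Bateman–Horn 1962, p. 365.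
[cite: HardyLittlewood1923, §5.42 p. 48 (Conjecture E)] -/
theorem polyRootCountMod_X_sq_add_one_holds : polyRootCountMod_X_sq_add_one := by
  intro p hp hp2
  haveI := Fact.mk hp
  rw [add_comm (1 : ℤ), ← legendreSym.at_neg_one hp2, ← legendreSym.card_sqrts p hp2 (-1),
    Nat.cast_inj]
  unfold polyRootCountMod
  simp only [Fin.prod_univ_one, Matrix.cons_val_fin_one, eval_add, eval_pow, eval_X, eval_one]
  refine card_bij (fun n _ ↦ (n : ZMod p)) (fun n hn ↦ ?_) (fun a ha b hb hab ↦ ?_)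
    (fun x hx ↦ ?_)
  · simp only [mem_filter, mem_range] at hn
    simp only [Set.mem_toFinset, Set.mem_setOf_eq, Int.cast_neg, Int.cast_one]
    have h := (ZMod.intCast_zmod_eq_zero_iff_dvd _ p).mpr hn.2
    push_cast at h
    exact eq_neg_of_add_eq_zero_left h
  · simp only [mem_filter, mem_range] at ha hb
    have h := congrArg ZMod.val hab
    rwa [ZMod.val_natCast_of_lt ha.1, ZMod.val_natCast_of_lt hb.1] at h
  · simp only [Set.mem_toFinset, Set.mem_setOf_eq, Int.cast_neg, Int.cast_one] at hx
    refine ⟨x.val, ?_, ZMod.natCast_zmod_val x⟩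
    simp only [mem_filter, mem_range]
    refine ⟨ZMod.val_lt x, ?_⟩
    rw [← ZMod.intCast_zmod_eq_zero_iff_dvd]
    push_cast
    rw [ZMod.natCast_zmod_val, hx, neg_add_cancel]

/-! ### `X² + 1` as a Bateman–Horn system: the Euler factors -/

/-- **Bateman–Horn 1962, (1) for `f = n² + 1`** (termwise): for every `x`,
`∏_{p ≤ x} (1 - 1/p)⁻¹ (1 - ω_{X²+1}(p)/p) = ∏_{2 < p ≤ x} (1 - χ₋₄(p)/(p - 1))`, because the
`p = 2` factor is `(1 - 1/2)⁻¹ (1 - 1/2) = 1` (`ω(2) = 1`) and for odd `p`,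
`(1 - 1/p)⁻¹ (1 - (1 + χ₋₄(p))/p) = (p - 1 - χ₋₄(p))/(p - 1)`; this is how Bateman–Horn's
`C(f)` of their (1) specialises to Hardy–Littlewood's product for `f = n² + 1` (the case they
refer to on p. 365). [cite: BatemanHornMathComp1962, (1) and p. 365 (case n² + 1)] -/
theorem batemanHornPartial_X_sq_add_one (x : ℕ) :
    batemanHornPartial ![(X ^ 2 + 1 : ℤ[X])] x =
      ∏ p ∈ (Nat.primesLE x).filter (2 < ·), (1 - (ZMod.χ₄ p : ℝ) / ((p : ℝ) - 1)) := by
  rw [prod_filter, batemanHornPartial]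
  refine prod_congr rfl fun p hp ↦ ?_
  have hp' : p.Prime := (Nat.mem_primesLE.mp hp).2
  rw [Fintype.card_fin, pow_one]
  split_ifs with h2
  · have hω' : (polyRootCountMod ![(X ^ 2 + 1 : ℤ[X])] p : ℝ) = 1 + (ZMod.χ₄ p : ℝ) := by
      exact_mod_cast polyRootCountMod_X_sq_add_one_holds hp' (by omega)
    have hp0 : (p : ℝ) ≠ 0 := by exact_mod_cast hp'.ne_zero
    have hp1 : (p : ℝ) - 1 ≠ 0 := by
      have : (1 : ℝ) < p := by exact_mod_cast hp'.one_lt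
      linarith
    rw [hω', one_sub_div hp0, inv_div]
    field_simp
    ring
  · obtain rfl : p = 2 := le_antisymm (not_lt.mp h2) hp'.two_le
    rw [polyRootCountMod_X_sq_add_one_two]
    norm_num

/-- Hence `HasBatemanHornConst ![X² + 1] C` is literally the convergence of Hardy–Littlewood's
ordered product `∏_{2 < p ≤ x} (1 - χ₋₄(p)/(p - 1)) → C`.
[cite: BatemanHornMathComp1962, (1) and p. 365 (case n² + 1)] -/
theorem hasBatemanHornConst_X_sq_add_one_iff (C : ℝ) :
    HasBatemanHornConst ![(X ^ 2 + 1 : ℤ[X])] C ↔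
      Tendsto (fun x : ℕ ↦ ∏ p ∈ (Nat.primesLE x).filter (2 < ·),
        (1 - (ZMod.χ₄ p : ℝ) / ((p : ℝ) - 1))) atTop (𝓝 C) := by
  unfold HasBatemanHornConst
  rw [show batemanHornPartial ![(X ^ 2 + 1 : ℤ[X])] = fun x : ℕ ↦
      ∏ p ∈ (Nat.primesLE x).filter (2 < ·), (1 - (ZMod.χ₄ p : ℝ) / ((p : ℝ) - 1)) from
    funext batemanHornPartial_X_sq_add_one]

/-- **Bateman–Horn 1962, (1) for `f = n² + 1`** (`k = 1`, `h₁ = 2`): the Bateman–Horn asymptotic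
for the single polynomial `X² + 1` is *the same statement* as the tree's `HardyLittlewoodConjE`
(`#{m ≤ x : m² + 1 prime} ∼ (C/2) x/log x` with `C` the ordered Euler product).
[cite: BatemanHornMathComp1962, (1) and p. 365 (case n² + 1)] -/
theorem batemanHornAsymptotic_X_sq_add_one_iff :
    BatemanHornAsymptotic ![(X ^ 2 + 1 : ℤ[X])] ↔ HardyLittlewoodConjE := by
  unfold BatemanHornAsymptotic HardyLittlewoodConjE
  refine exists_congr fun C ↦ and_congr (hasBatemanHornConst_X_sq_add_one_iff C) ?_
  have hdeg : (X ^ 2 + 1 : ℤ[X]).natDegree = 2 := by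
    simpa using natDegree_X_pow_add_C (n := 2) (r := (1 : ℤ))
  simp only [Fin.prod_univ_one, Matrix.cons_val_fin_one, hdeg, Fintype.card_fin, pow_one,
    polyPrimeCount_X_sq_add_one, Nat.cast_ofNat]

/-- **Discharge of `hardyLittlewoodConjE_of_batemanHorn`**: the Bateman–Horn conjecture implies
Hardy–Littlewood's Conjecture E, as its case `f = X² + 1` (`isBatemanHornSystem_X_sq_add_one`).
[cite: BatemanHornMathComp1962, (1) and p. 365 (case n² + 1)] -/
theorem hardyLittlewoodConjE_of_batemanHorn_holds : hardyLittlewoodConjE_of_batemanHorn :=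
  fun hBH ↦ batemanHornAsymptotic_X_sq_add_one_iff.mp (hBH 1 _ isBatemanHornSystem_X_sq_add_one)

/-! ### Convergence of Hardy–Littlewood's product (unconditional) -/

/-- The Bateman–Horn partial products of `X² + 1` converge to `hardyLittlewoodEConst`, which is
positive: the case `f = X² + 1` (`isBatemanHornSystem_X_sq_add_one`) of the proved convergence
theorem `IsBatemanHornSystem.hasBatemanHornConst_holds` (Bateman–Horn 1962, pp. 364–365).
[cite: BatemanHornMathComp1962, pp. 364–365 (convergence of the product)] -/
theorem hasBatemanHornConst_hardyLittlewoodEConst :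
    HasBatemanHornConst ![(X ^ 2 + 1 : ℤ[X])] hardyLittlewoodEConst ∧ 0 < hardyLittlewoodEConst :=
  IsBatemanHornSystem.hasBatemanHornConst_holds isBatemanHornSystem_X_sq_add_one

/-- **Discharge of `tendsto_hardyLittlewoodE_partial`**: Hardy–Littlewood's ordered product
`∏_{2 < p ≤ x} (1 - χ₋₄(p)/(p - 1))` converges to `hardyLittlewoodEConst` as `x → ∞`
(unconditionally: Bateman–Horn 1962, pp. 364–365, for `f = n² + 1`, through
`IsBatemanHornSystem.hasBatemanHornConst_holds` and `batemanHornPartial_X_sq_add_one`).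
[cite: BatemanHornMathComp1962, pp. 364–365 and p. 365 (case n² + 1)] -/
theorem tendsto_hardyLittlewoodE_partial_holds : tendsto_hardyLittlewoodE_partial :=
  (hasBatemanHornConst_X_sq_add_one_iff _).mp hasBatemanHornConst_hardyLittlewoodEConst.1

/-- `hardyLittlewoodEConst > 0` (Bateman–Horn 1962, p. 364: "converges to a positive limit").
[cite: BatemanHornMathComp1962, pp. 364–365] -/
theorem hardyLittlewoodEConst_pos : 0 < hardyLittlewoodEConst :=
  hasBatemanHornConst_hardyLittlewoodEConst.2

/-- With the convergence of the product proved, Conjecture E is equivalent to the bare asymptotic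
`#{m ≤ x : m² + 1 prime} ∼ (hardyLittlewoodEConst / 2) · x / log x` (limits in `ℝ` are unique;
cf. `HardyLittlewoodConjE.isEquivalent`). [cite: BatemanHornMathComp1962, (1) and p. 365 (case n² + 1)] -/
theorem hardyLittlewoodConjE_iff_isEquivalent :
    HardyLittlewoodConjE ↔
      (fun x : ℕ ↦ (nSqAddOnePrimeCount x : ℝ)) ~[atTop]
        fun x : ℕ ↦ hardyLittlewoodEConst / 2 * (x : ℝ) / Real.log x :=
  ⟨fun h ↦ h.isEquivalent tendsto_hardyLittlewoodE_partial_holds,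
    fun h ↦ ⟨hardyLittlewoodEConst, tendsto_hardyLittlewoodE_partial_holds, h⟩⟩

/-! ### Consequences of Conjecture E: positivity of the constant, Landau's problem -/

/-- Under Conjecture E the constant `C` of the statement is `hardyLittlewoodEConst`, hence
positive. [cite: BatemanHornMathComp1962, pp. 364–365] -/
theorem HardyLittlewoodConjE.const_pos (h : HardyLittlewoodConjE) :
    ∃ C : ℝ, 0 < C ∧
      Tendsto (fun x : ℕ ↦ ∏ p ∈ (Nat.primesLE x).filter (2 < ·),
        (1 - (ZMod.χ₄ p : ℝ) / ((p : ℝ) - 1))) atTop (𝓝 C) ∧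
      (fun x : ℕ ↦ (nSqAddOnePrimeCount x : ℝ)) ~[atTop]
        fun x : ℕ ↦ C / 2 * (x : ℝ) / Real.log x :=
  ⟨hardyLittlewoodEConst, hardyLittlewoodEConst_pos, tendsto_hardyLittlewoodE_partial_holds,
    hardyLittlewoodConjE_iff_isEquivalent.mp h⟩

/-- If `#{m ≤ x : m² + 1 prime} ∼ (C/2) x/log x` with `C > 0` then the count tends to infinity.
[folklore] -/
theorem tendsto_nSqAddOnePrimeCount_atTop {C : ℝ} (hC : 0 < C)
    (hQ : (fun x : ℕ ↦ (nSqAddOnePrimeCount x : ℝ)) ~[atTop]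
      fun x : ℕ ↦ C / 2 * (x : ℝ) / Real.log x) :
    Tendsto (fun x : ℕ ↦ (nSqAddOnePrimeCount x : ℝ)) atTop atTop := by
  refine hQ.symm.tendsto_atTop ?_
  have := tendsto_natCast_div_log_atTop.const_mul_atTop (show 0 < C / 2 by positivity)
  simpa [mul_div_assoc] using this

/-- **Conjecture E implies Landau's conjecture** (`n² + 1` is prime for infinitely many `n`,
the tree's `Parity.LandauConjecture`): the count `#{m ≤ x : m² + 1 prime}` tends to infinity.
Hardy–Littlewood 1923, §5.41 ("the third [of Landau's problems] was that of the existence of an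
infinity of primes of the form `m² + 1`"). [cite: HardyLittlewood1923, §5.41–§5.42] -/
theorem HardyLittlewoodConjE.landauConjecture (h : HardyLittlewoodConjE) :
    Sieve.LandauConjecture := by
  obtain ⟨C, hCpos, -, hQ⟩ := h.const_pos
  have hlim := tendsto_nSqAddOnePrimeCount_atTop hCpos hQ
  refine Set.infinite_of_forall_exists_gt fun n ↦ ?_
  by_contra hcon
  push Not at hcon
  have hbound : ∀ x, (nSqAddOnePrimeCount x : ℝ) ≤ (n + 1 : ℕ) := by
    intro x
    unfold nSqAddOnePrimeCount
    exact_mod_cast (card_le_card (fun m hm ↦ by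
      simp only [mem_filter, mem_Icc, mem_range] at hm ⊢
      have := hcon m hm.2
      omega)).trans (card_range (n + 1)).le
  obtain ⟨x, hx⟩ := (hlim.eventually (eventually_gt_atTop ((n + 1 : ℕ) : ℝ))).exists
  exact absurd hx (not_lt.mpr (hbound x))

/-- "Infinitely many primes of the form `m² + 1`" (Hardy–Littlewood's wording) is the same as
"`n² + 1` is prime for infinitely many `n`" (Landau's, the tree's `Parity.LandauConjecture`),
`m ↦ m² + 1` being injective. [folklore] -/
theorem setOf_prime_eq_sq_add_one_infinite_iff :
    {q : ℕ | q.Prime ∧ ∃ m : ℕ, q = m ^ 2 + 1}.Infinite ↔ Sieve.LandauConjecture := by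
  have hset : {q : ℕ | q.Prime ∧ ∃ m : ℕ, q = m ^ 2 + 1} =
      (fun m : ℕ ↦ m ^ 2 + 1) '' {m : ℕ | (m ^ 2 + 1).Prime} := by
    ext q
    simp only [Set.mem_setOf_eq, Set.mem_image]
    constructor
    · rintro ⟨hq, m, rfl⟩
      exact ⟨m, hq, rfl⟩
    · rintro ⟨m, hm, rfl⟩
      exact ⟨hm, m, rfl⟩
  rw [hset, Set.infinite_image_iff fun a _ b _ h ↦ Nat.pow_left_injective two_ne_zero
    (Nat.add_right_cancel h)]
  rfl

/-! ### Conjecture E as printed: `P(n) ∼ C √n / log n` -/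

/-- `P(n) = Q(⌊√(n - 2)⌋)`, where `P(n)` is "the number of primes of the form `m² + 1` and less
than `n`" (Hardy–Littlewood 1923, §5.41 (5.413)) and `Q(x) = #{1 ≤ m ≤ x : m² + 1 prime}`
(`nSqAddOnePrimeCount`): a prime `q = m² + 1 < n` has `m ≥ 1` and `m² ≤ n - 2`, and `m ↦ m² + 1`
is injective. [cite: HardyLittlewood1923, §5.41 (5.413)] -/
theorem ncard_setOf_prime_sq_add_one_lt (n : ℕ) :
    Set.ncard {q : ℕ | q < n ∧ q.Prime ∧ ∃ m : ℕ, q = m ^ 2 + 1} =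
      nSqAddOnePrimeCount (Nat.sqrt (n - 2)) := by
  unfold nSqAddOnePrimeCount
  have hset : {q : ℕ | q < n ∧ q.Prime ∧ ∃ m : ℕ, q = m ^ 2 + 1} =
      ↑(({m ∈ Icc 1 (Nat.sqrt (n - 2)) | (m ^ 2 + 1).Prime}).image fun m ↦ m ^ 2 + 1) := by
    ext q
    simp only [Set.mem_setOf_eq, coe_image, coe_filter, Set.mem_image, mem_Icc, Set.mem_setOf_eq]
    constructor
    · rintro ⟨hqn, hq, m, rfl⟩
      refine ⟨m, ⟨⟨?_, Nat.le_sqrt'.mpr ?_⟩, hq⟩, rfl⟩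
      · rcases Nat.eq_zero_or_pos m with rfl | hm
        · exact absurd hq (by decide)
        · exact hm
      · have := m ^ 2
        omega
    · rintro ⟨m, ⟨⟨hm1, hm2⟩, hq⟩, rfl⟩
      refine ⟨?_, hq, m, rfl⟩
      have h2 := Nat.le_sqrt'.mp hm2
      have h1 : 1 ≤ m ^ 2 := Nat.one_le_pow _ _ hm1
      omega
  rw [hset, Set.ncard_coe_finset, card_image_of_injective _ fun a b h ↦
    Nat.pow_left_injective two_ne_zero (Nat.add_right_cancel h)]

/-- In particular `Q(x) = P(x² + 2)`. [folklore] -/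
theorem nSqAddOnePrimeCount_eq_ncard (x : ℕ) :
    nSqAddOnePrimeCount x =
      Set.ncard {q : ℕ | q < x ^ 2 + 2 ∧ q.Prime ∧ ∃ m : ℕ, q = m ^ 2 + 1} := by
  rw [ncard_setOf_prime_sq_add_one_lt, Nat.add_sub_cancel, Nat.sqrt_eq']

/-- The printed partial products `∏_{3 ≤ ϖ ≤ x} (1 - (1/(ϖ-1)) (−1/ϖ))` are the tree's
`∏_{2 < p ≤ x} (1 - χ₋₄(p)/(p - 1))` (`(−1/p) = χ₋₄(p)` for odd `p`, `jacobiSym.at_neg_one`).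
[folklore] -/
theorem hardyLittlewood1923_partial_eq (x : ℕ) :
    ∏ p ∈ (Nat.primesLE x).filter (3 ≤ ·), (1 - 1 / ((p : ℝ) - 1) * (jacobiSym (-1) p : ℝ)) =
      ∏ p ∈ (Nat.primesLE x).filter (2 < ·), (1 - (ZMod.χ₄ p : ℝ) / ((p : ℝ) - 1)) := by
  refine prod_congr (filter_congr fun p _ ↦ Iff.rfl) fun p hp ↦ ?_
  simp only [mem_filter, Nat.mem_primesLE] at hp
  rw [jacobiSym.at_neg_one (hp.1.2.odd_of_ne_two (by omega))]
  ring

/-- A function at bounded distance from one tending to `+∞` is asymptotically equivalent to it.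
[folklore] -/
theorem isEquivalent_of_abs_sub_le {α : Type*} {l : Filter α} {u v : α → ℝ} {M : ℝ}
    (h : ∀ᶠ n in l, |u n - v n| ≤ M) (hv : Tendsto v l atTop) : u ~[l] v := by
  have h1 : (u - v) =O[l] (fun _ ↦ (1 : ℝ)) :=
    IsBigO.of_bound M (by filter_upwards [h] with n hn; simpa using hn)
  have h2 : (fun _ ↦ (1 : ℝ)) =o[l] v :=
    (isLittleO_one_left_iff ℝ).mpr (tendsto_norm_atTop_atTop.comp hv)
  exact h1.trans_isLittleO h2

/-- `⌊√(n - 2)⌋ ∼ √n`. [folklore] -/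
theorem isEquivalent_nat_sqrt_sub_two :
    (fun n : ℕ ↦ (Nat.sqrt (n - 2) : ℝ)) ~[atTop] fun n : ℕ ↦ Real.sqrt n := by
  refine isEquivalent_of_abs_sub_le (M := 2) (Eventually.of_forall fun n ↦ abs_le.mpr ⟨?_, ?_⟩)
    (Real.tendsto_sqrt_atTop.comp tendsto_natCast_atTop_atTop)
  · -- `√n ≤ ⌊√(n-2)⌋ + 2` since `n ≤ (⌊√(n-2)⌋ + 2)²`
    set s := Nat.sqrt (n - 2) with hs
    have h1 : n - 2 < (s + 1) ^ 2 := Nat.lt_succ_sqrt' (n - 2)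
    have h2 : n ≤ (s + 2) ^ 2 := by
      have : (s + 2) ^ 2 = (s + 1) ^ 2 + 2 * s + 3 := by ring
      omega
    have h3 : Real.sqrt n ≤ s + 2 := by
      rw [Real.sqrt_le_left (by positivity)]
      exact_mod_cast h2
    linarith
  · have h1 : ((n - 2 : ℕ) : ℝ) ≤ (n : ℝ) := by exact_mod_cast Nat.sub_le n 2
    have h2 : (Nat.sqrt (n - 2) : ℝ) ≤ Real.sqrt n :=
      Real.nat_sqrt_le_real_sqrt.trans (Real.sqrt_le_sqrt h1)
    linarith

/-- `√(x² + 2) ∼ x`. [folklore] -/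
theorem isEquivalent_sqrt_sq_add_two :
    (fun x : ℕ ↦ Real.sqrt ((x ^ 2 + 2 : ℕ) : ℝ)) ~[atTop] fun x : ℕ ↦ (x : ℝ) := by
  refine isEquivalent_of_abs_sub_le (M := 2) (Eventually.of_forall fun x ↦ abs_le.mpr ⟨?_, ?_⟩)
    tendsto_natCast_atTop_atTop
  · have : (x : ℝ) ≤ Real.sqrt ((x ^ 2 + 2 : ℕ) : ℝ) := by
      rw [Real.le_sqrt (by positivity) (by positivity)]
      exact_mod_cast Nat.le_add_right _ _
    linarith
  · have : Real.sqrt ((x ^ 2 + 2 : ℕ) : ℝ) ≤ x + 2 := by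
      rw [Real.sqrt_le_left (by positivity)]
      push_cast
      nlinarith [Nat.cast_nonneg (α := ℝ) x]
    linarith

/-- `x² + 2 ∼ x²`. [folklore] -/
theorem isEquivalent_sq_add_two :
    (fun x : ℕ ↦ ((x ^ 2 + 2 : ℕ) : ℝ)) ~[atTop] fun x : ℕ ↦ (x : ℝ) ^ 2 := by
  refine isEquivalent_of_abs_sub_le (M := 2) (Eventually.of_forall fun x ↦ ?_)
    ((tendsto_pow_atTop two_ne_zero).comp tendsto_natCast_atTop_atTop)
  push_cast
  simp

/-- `⌊√(n - 2)⌋ → ∞`. [folklore] -/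
theorem tendsto_nat_sqrt_sub_two_atTop : Tendsto (fun n : ℕ ↦ Nat.sqrt (n - 2)) atTop atTop := by
  refine tendsto_atTop_atTop.mpr fun b ↦ ⟨b ^ 2 + 2, fun n hn ↦ ?_⟩
  exact Nat.le_sqrt'.mpr (by omega)

/-- **Faithfulness of parity.S37: Conjecture E as printed.** Hardy–Littlewood, Acta Math. 44
(1923), §5.42, p. 48: "Conjecture E. There are infinitely many primes of the form `m² + 1`. The
number `P(n)` of such primes less than `n` is given asymptotically by `P(n) ∼ C √n / log n`,
where `C = ∏_{ϖ=3}^{∞} (1 - (1/(ϖ - 1)) (−1/ϖ))`." Here `(−1/ϖ)` is the Legendre symbol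
(Mathlib's `jacobiSym (-1) ϖ`, equal to it at odd primes) and the product over the primes
`ϖ ≥ 3` in increasing order is, as in the tree, the ordered limit of the partial products over
`3 ≤ ϖ ≤ x` (only conditionally convergent — footnote 1, p. 47: "(5.412) is not absolutely
convergent"; it does converge, `tendsto_hardyLittlewoodE_partial_holds`). The right-hand side
below is this printed statement verbatim, `P(n)` being the cardinality of
`{q < n : q prime, q = m² + 1 for some m}`; the tree's `HardyLittlewoodConjE` (**parity.S37**,
`#{m ≤ x : m² + 1 prime} ∼ (C/2) x/log x`) is its `m ≤ x` reparametrisation (`x = √n`). Proof: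
forward, `P(n) = Q(⌊√(n-2)⌋)`, `(C/2) ⌊√(n-2)⌋/log ⌊√(n-2)⌋ ∼ (C/2) √n/(½ log n)`, infinitude
from `HardyLittlewoodConjE.landauConjecture`; backward, `Q(x) = P(x² + 2)` and
`C √(x²+2)/log(x²+2) ∼ C x/(2 log x)`. [cite: HardyLittlewood1923, Conjecture E, §5.42 p. 48] -/
theorem hardyLittlewoodConjE_iff_printed :
    HardyLittlewoodConjE ↔
      ({q : ℕ | q.Prime ∧ ∃ m : ℕ, q = m ^ 2 + 1}.Infinite ∧
        ∃ C : ℝ,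
          Tendsto (fun x : ℕ ↦ ∏ p ∈ (Nat.primesLE x).filter (3 ≤ ·),
            (1 - 1 / ((p : ℝ) - 1) * (jacobiSym (-1) p : ℝ))) atTop (𝓝 C) ∧
          (fun n : ℕ ↦ (Set.ncard {q : ℕ | q < n ∧ q.Prime ∧ ∃ m : ℕ, q = m ^ 2 + 1} : ℝ))
            ~[atTop] fun n : ℕ ↦ C * Real.sqrt n / Real.log n) := by
  have hprod : (fun x : ℕ ↦ ∏ p ∈ (Nat.primesLE x).filter (3 ≤ ·),
      (1 - 1 / ((p : ℝ) - 1) * (jacobiSym (-1) p : ℝ))) = fun x : ℕ ↦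
        ∏ p ∈ (Nat.primesLE x).filter (2 < ·), (1 - (ZMod.χ₄ p : ℝ) / ((p : ℝ) - 1)) :=
    funext hardyLittlewood1923_partial_eq
  constructor
  · intro h
    obtain ⟨C, hC, hQ⟩ := h
    refine ⟨setOf_prime_eq_sq_add_one_infinite_iff.mpr
      (HardyLittlewoodConjE.landauConjecture ⟨C, hC, hQ⟩), C, hprod ▸ hC, ?_⟩
    have h1 : (fun n : ℕ ↦ (nSqAddOnePrimeCount (Nat.sqrt (n - 2)) : ℝ)) ~[atTop]
        fun n : ℕ ↦ C / 2 * (Nat.sqrt (n - 2) : ℝ) / Real.log (Nat.sqrt (n - 2)) :=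
      hQ.comp_tendsto tendsto_nat_sqrt_sub_two_atTop
    have hlog : (fun n : ℕ ↦ Real.log (Nat.sqrt (n - 2))) ~[atTop]
        fun n : ℕ ↦ Real.log n / 2 := by
      refine (isEquivalent_nat_sqrt_sub_two.log
        (Real.tendsto_sqrt_atTop.comp tendsto_natCast_atTop_atTop)).congr_right ?_
      exact Eventually.of_forall fun n ↦ Real.log_sqrt (Nat.cast_nonneg n)
    have h2 : (fun n : ℕ ↦ C / 2 * (Nat.sqrt (n - 2) : ℝ) / Real.log (Nat.sqrt (n - 2)))
        ~[atTop] fun n : ℕ ↦ C / 2 * Real.sqrt n / (Real.log n / 2) :=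
      (IsEquivalent.refl.mul isEquivalent_nat_sqrt_sub_two).div hlog
    have h3 : (fun n : ℕ ↦ C / 2 * Real.sqrt n / (Real.log n / 2)) =
        fun n : ℕ ↦ C * Real.sqrt n / Real.log n := by
      funext n
      ring
    have h0 : (fun n : ℕ ↦
        (Set.ncard {q : ℕ | q < n ∧ q.Prime ∧ ∃ m : ℕ, q = m ^ 2 + 1} : ℝ)) =
        fun n : ℕ ↦ (nSqAddOnePrimeCount (Nat.sqrt (n - 2)) : ℝ) :=
      funext fun n ↦ by rw [ncard_setOf_prime_sq_add_one_lt]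
    rw [h0, ← h3]
    exact h1.trans h2
  · rintro ⟨-, C, hC, hP⟩
    refine ⟨C, hprod ▸ hC, ?_⟩
    have hk : Tendsto (fun x : ℕ ↦ x ^ 2 + 2) atTop atTop :=
      tendsto_atTop_atTop.mpr fun b ↦ ⟨b, fun x hx ↦ hx.trans (by nlinarith)⟩
    have h1 : (fun x : ℕ ↦
        (Set.ncard {q : ℕ | q < x ^ 2 + 2 ∧ q.Prime ∧ ∃ m : ℕ, q = m ^ 2 + 1} : ℝ)) ~[atTop]
        fun x : ℕ ↦ C * Real.sqrt ((x ^ 2 + 2 : ℕ) : ℝ) / Real.log ((x ^ 2 + 2 : ℕ) : ℝ) :=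
      hP.comp_tendsto hk
    have hlog : (fun x : ℕ ↦ Real.log ((x ^ 2 + 2 : ℕ) : ℝ)) ~[atTop]
        fun x : ℕ ↦ 2 * Real.log x := by
      refine (isEquivalent_sq_add_two.log
        ((tendsto_pow_atTop two_ne_zero).comp tendsto_natCast_atTop_atTop)).congr_right ?_
      exact Eventually.of_forall fun x ↦ by simp [Real.log_pow]
    have h2 : (fun x : ℕ ↦ C * Real.sqrt ((x ^ 2 + 2 : ℕ) : ℝ) / Real.log ((x ^ 2 + 2 : ℕ) : ℝ))
        ~[atTop] fun x : ℕ ↦ C * (x : ℝ) / (2 * Real.log x) :=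
      (IsEquivalent.refl.mul isEquivalent_sqrt_sq_add_two).div hlog
    have h3 : (fun x : ℕ ↦ C * (x : ℝ) / (2 * Real.log x)) =
        fun x : ℕ ↦ C / 2 * (x : ℝ) / Real.log x := by
      funext x
      ring
    have h0 : (fun x : ℕ ↦ (nSqAddOnePrimeCount x : ℝ)) = fun x : ℕ ↦
        (Set.ncard {q : ℕ | q < x ^ 2 + 2 ∧ q.Prime ∧ ∃ m : ℕ, q = m ^ 2 + 1} : ℝ) :=
      funext fun x ↦ by rw [nSqAddOnePrimeCount_eq_ncard]
    rw [h0, ← h3]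
    exact h1.trans h2

/-- The printed Conjecture E with the constant made explicit: by `hardyLittlewoodConjE_iff_printed`,
`tendsto_hardyLittlewoodE_partial_holds` and uniqueness of limits, `HardyLittlewoodConjE` holds iff
there are infinitely many primes `m² + 1` and `P(n) ∼ 𝔖 √n / log n` with
`𝔖 = hardyLittlewoodEConst = ∏_{ϖ ≥ 3} (1 - (1/(ϖ - 1)) (−1/ϖ))` (the product converges to it).
[cite: HardyLittlewood1923, Conjecture E, §5.42 p. 48] -/
theorem hardyLittlewoodConjE_iff_printed_hardyLittlewoodEConst :
    HardyLittlewoodConjE ↔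
      ({q : ℕ | q.Prime ∧ ∃ m : ℕ, q = m ^ 2 + 1}.Infinite ∧
        (fun n : ℕ ↦ (Set.ncard {q : ℕ | q < n ∧ q.Prime ∧ ∃ m : ℕ, q = m ^ 2 + 1} : ℝ))
          ~[atTop] fun n : ℕ ↦ hardyLittlewoodEConst * Real.sqrt n / Real.log n) := by
  have hE : Tendsto (fun x : ℕ ↦ ∏ p ∈ (Nat.primesLE x).filter (3 ≤ ·),
      (1 - 1 / ((p : ℝ) - 1) * (jacobiSym (-1) p : ℝ))) atTop (𝓝 hardyLittlewoodEConst) := by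
    rw [show (fun x : ℕ ↦ ∏ p ∈ (Nat.primesLE x).filter (3 ≤ ·),
        (1 - 1 / ((p : ℝ) - 1) * (jacobiSym (-1) p : ℝ))) = fun x : ℕ ↦
          ∏ p ∈ (Nat.primesLE x).filter (2 < ·), (1 - (ZMod.χ₄ p : ℝ) / ((p : ℝ) - 1)) from
      funext hardyLittlewood1923_partial_eq]
    exact tendsto_hardyLittlewoodE_partial_holds
  rw [hardyLittlewoodConjE_iff_printed]
  constructor
  · rintro ⟨hinf, C, hC, hP⟩
    obtain rfl : C = hardyLittlewoodEConst := tendsto_nhds_unique hC hE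
    exact ⟨hinf, hP⟩
  · rintro ⟨hinf, hP⟩
    exact ⟨hinf, hardyLittlewoodEConst, hE, hP⟩

end Literature.NumberTheory.Sieve
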